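import Summits.FinalStateConjecture.FinalStateConjecture.Theses.LaminatedThreshold
import Literature.Geometry.Lorentzian.ExactKerrEnd

/-!
# Repair sketch for route LaminatedThreshold (crux-strategist advice to the route's planner; NOT a route edit)

planner-cstrat-stmt-FinalStateConjecture-16894-b1-0 · 2026-08-17.

If crux B `TameExitsLocalise` is restated to the Corvino–Schoen class (`TameExitsLocaliseKerrEnded`: Kerr-ended base
datum, conclusion = jointly smooth admissible family of EXACT KERR LEAVES OFF ONE COMPACT SET with floating parameters,
good on a punctured window) and crux A is asked to produce a KERR-ENDED laminated datum with saturation along such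
families (`LaminatedThresholdKerrEnded`), the deciding theorem survives with the same one-page lamination argument:
`closesKerrEnded : LaminatedThresholdKerrEnded → TameExitsLocaliseKerrEnded → ¬ FinalStateConjecture` (proved below,
sorry-free). Both new statements are immune to the far-field geometric-optics artefact of STRATEGY-CENSUS.md §Negation
(exact Kerr tails carry no high-frequency content) and B's Killing-tail/KID obstruction disappears (floating
parameters = Corvino–Schoen's cokernel). `TameExitsLocaliseKerrEnded` is a WEAKENING of the current B
(`StrategistSketch.kerrEnded_of_tameExitsLocalise`); `LaminatedThresholdKerrEnded` is neither weaker nor stronger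
than the current A (Kerr-endedness of `d⋆` added; saturation demanded along a larger class of families).

To adopt: `ledger workitem add --kind statement --route route-FinalStateConjecture-LaminatedThreshold --rank 2/3
--name LaminatedThresholdKerrEnded / TameExitsLocaliseKerrEnded --signature '<bodies below>' …`, then a glue file whose
`closes` is `closesKerrEnded` with the two new decl names, `ledger route check --native --id … --closes-file`, and
`ledger route edit … --closes-file … --drop TameExitsLocalise --drop LaminatedThreshold` (or keep the old pair as asides).
-/

noncomputable section

namespace Summit.FinalStateConjecture.FinalStateConjecture.Cruxes.TameExitsLocalise.Strategist.Repair

set_option linter.dupNamespace false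

open scoped BigOperators Topology Manifold ContDiff Classical
open Filter Set Function TopologicalSpace
open Literature.Geometry.Lorentzian

section Vocabulary

variable {X : Type} [TopologicalSpace X] [ChartedSpace E3 X] [IsManifold (𝓡 3) ∞ X] [T2Space X]
  [SecondCountableTopology X] [ConnectedSpace X]

/-- GOOD datum (verbatim the summit's property). -/
def Good (D : InitialDataSet (𝓡 3) X) : Prop :=
  (∃ 𝒟 : VacuumCauchyDevelopment D, 𝒟.IsMaximal) ∧
    ∀ 𝒟 : VacuumCauchyDevelopment D, 𝒟.IsMaximal →
      Summit.FinalStateConjecture.HasCompleteNullInfinity 𝒟.toCauchyDevelopment ∧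
        ∃ (O : Set 𝒟.carrier) (d : FinalStateDecomposition 𝒟.toSpacetime O 2),
          (∀ i, Kerr.IsSubextremal (d.mass i) (d.spin i)) ∧
            O = Summit.FinalStateConjecture.exteriorOf 𝒟.toCauchyDevelopment d.charted ∧
              Summit.FinalStateConjecture.RaysStayInClosure 𝒟.toCauchyDevelopment O ∧
                Summit.FinalStateConjecture.HasExhaustiveCharts d ∧
                  Summit.FinalStateConjecture.IsFutureOriented d

/-- **Corvino–Schoen-class family**: all members are exact Kerr leaves off ONE compact set (parameters, chart and leaf
may depend on the parameter `c`). -/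
def IsKerrEndedFamily (F : EuclideanSpace ℝ (Fin 1) → InitialDataSet (𝓡 3) X) : Prop :=
  ∀ [Kerr.Facts], ∃ K : Set X, IsCompact K ∧ ∀ c, ∃ (U : Opens E3) (M a r₀ : ℝ) (hM : 0 ≤ M) (φ : U → X)
    (ψ : U → Kerr.region a r₀) (ν : NormalField 𝓘(ℝ, E4) ψ), (F c).IsExactKerrEndAlong K U M a r₀ hM φ ψ ν

end Vocabulary

/-- **A_CS — laminated threshold at a Kerr-ended datum, saturation along Corvino–Schoen-class families.** -/
def LaminatedThresholdKerrEnded : Prop :=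
  ∃ (X : Type) (_ : TopologicalSpace X) (_ : ChartedSpace E3 X) (_ : IsManifold (𝓡 3) ∞ X) (_ : T2Space X)
    (_ : SecondCountableTopology X) (_ : ConnectedSpace X) (dstar : InitialDataSet (𝓡 3) X)
    (Φ : InitialDataSet (𝓡 3) X → ℝ) (K : Set ℝ),
    dstar ∈ admissibleVacuumData X ∧ ¬ Good dstar ∧ dstar.HasExactKerrEnd ∧ Φ dstar ∈ K ∧
    (∀ ε : ℝ, 0 < ε → (K ∩ Set.Ioo (Φ dstar - ε) (Φ dstar)).Nonempty ∧ (K ∩ Set.Ioo (Φ dstar) (Φ dstar + ε)).Nonempty) ∧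
    ∀ F : EuclideanSpace ℝ (Fin 1) → InitialDataSet (𝓡 3) X,
      InitialDataSet.IsSmoothDataFamily 1 F → F 0 = dstar → (∀ c, F c ∈ admissibleVacuumData X) →
      IsKerrEndedFamily F →
      ∃ δ : ℝ, 0 < δ ∧ ContinuousOn (fun c ↦ Φ (F c)) (Metric.ball 0 δ) ∧
        ∀ c ∈ Metric.ball (0 : EuclideanSpace ℝ (Fin 1)) δ, Φ (F c) ∈ K → ¬ Good (F c)

/-- **B_CS — tame exits at Kerr-ended exceptional data give Corvino–Schoen-class exits on a window.** (Verbatim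
`StrategistSketch.TameExitsLocaliseKerrEnded`.) -/
def TameExitsLocaliseKerrEnded : Prop :=
  ∀ (X : Type) [TopologicalSpace X] [ChartedSpace E3 X] [IsManifold (𝓡 3) ∞ X] [T2Space X]
    [SecondCountableTopology X] [ConnectedSpace X],
    ∀ dstar ∈ admissibleVacuumData X, dstar.HasExactKerrEnd → ¬ Good dstar →
      (∃ (e : AFEnd X) (F : EuclideanSpace ℝ (Fin 1) → InitialDataSet (𝓡 3) X),
        InitialDataSet.IsTameDataFamily e 1 F ∧ InitialDataSet.IsImmersedAtZero 1 F ∧ F 0 = dstar ∧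
        Function.Injective F ∧ (∀ c, F c ∈ admissibleVacuumData X) ∧ ∀ c, c ≠ 0 → Good (F c)) →
      ∃ F' : EuclideanSpace ℝ (Fin 1) → InitialDataSet (𝓡 3) X,
        InitialDataSet.IsSmoothDataFamily 1 F' ∧ F' 0 = dstar ∧ (∀ c, F' c ∈ admissibleVacuumData X) ∧
        IsKerrEndedFamily F' ∧
        ∃ ε : ℝ, 0 < ε ∧ ∀ c, c ≠ 0 → ‖c‖ < ε → Good (F' c)

/-- **Deciding theorem of the repaired route (proved).** Same lamination argument as the current `closes`. -/
theorem closesKerrEnded (hA : LaminatedThresholdKerrEnded) (hB : TameExitsLocaliseKerrEnded) :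
    ¬ FinalStateConjecture := by
  obtain ⟨X, i₁, i₂, i₃, i₄, i₅, i₆, dstar, Φ, K, hD, hbad, hKerr, hk, hacc, hsat⟩ := hA
  intro hFSC
  obtain ⟨e, F, hF, himm, h0, hinj, hadm, hexc⟩ := hFSC X dstar ⟨hD, hbad⟩
  obtain ⟨F', hF', h0', hadm', hKF', ε, hε, hgood⟩ :=
    hB X dstar hD hKerr hbad ⟨e, F, hF, himm, h0, hinj, hadm, fun c hc ↦ by
      by_contra hP
      exact hexc c hc ⟨hadm c, hP⟩⟩
  obtain ⟨δ, hδ, hcont, hK⟩ := hsat F' hF' h0' hadm' hKF'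
  -- the segment direction in the one-dimensional parameter space
  set v : EuclideanSpace ℝ (Fin 1) := EuclideanSpace.single (0 : Fin 1) (1 : ℝ) with hv
  have hnv : ‖v‖ = 1 := by simp [hv]
  have hv0 : v ≠ 0 := by
    intro h; rw [h, norm_zero] at hnv; exact zero_ne_one hnv
  set ρ : ℝ := min δ ε / 2 with hρ
  have hρpos : 0 < ρ := by positivity
  have hρδ : ρ < δ := by
    have : min δ ε ≤ δ := min_le_left _ _
    rw [hρ]; linarith
  have hρε : ρ < ε := by
    have : min δ ε ≤ ε := min_le_right _ _
    rw [hρ]; linarith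
  set f : ℝ → ℝ := fun t ↦ Φ (F' (t • v)) with hf
  have hnorm : ∀ t : ℝ, ‖t • v‖ = |t| := fun t ↦ by
    rw [norm_smul, hnv, mul_one, Real.norm_eq_abs]
  -- values along the punctured segment avoid K (good members carry no exceptional code)
  have hnotK : ∀ t ∈ Set.Ioo (0 : ℝ) ρ, f t ∉ K := by
    intro t ht hmem
    have htne : t • v ≠ 0 := smul_ne_zero (ne_of_gt ht.1) hv0
    have hball : t • v ∈ Metric.ball (0 : EuclideanSpace ℝ (Fin 1)) δ := by
      rw [mem_ball_zero_iff, hnorm, abs_of_pos ht.1]; exact ht.2.trans hρδ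
    have hlt : ‖t • v‖ < ε := by rw [hnorm, abs_of_pos ht.1]; exact ht.2.trans hρε
    exact hK (t • v) hball hmem (hgood (t • v) htne hlt)
  have hγ : Continuous fun t : ℝ ↦ t • v := continuous_id.smul continuous_const
  have hmaps : Set.MapsTo (fun t : ℝ ↦ t • v) (Set.Ioo 0 ρ) (Metric.ball 0 δ) := by
    intro t ht
    rw [mem_ball_zero_iff, hnorm, abs_of_pos ht.1]; exact ht.2.trans hρδ
  have hfcont : ContinuousOn f (Set.Ioo 0 ρ) := hcont.comp hγ.continuousOn hmaps
  have hf0 : f 0 = Φ dstar := by simp [hf, h0']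
  have hfat : ContinuousAt f 0 := by
    have h1 : ContinuousAt (fun c ↦ Φ (F' c)) 0 :=
      (hcont 0 (Metric.mem_ball_self hδ)).continuousAt (Metric.ball_mem_nhds 0 hδ)
    have h2 : ContinuousAt (fun t : ℝ ↦ t • v) 0 := hγ.continuousAt
    have h3 := ContinuousAt.comp_of_eq (g := fun c ↦ Φ (F' c)) (f := fun t : ℝ ↦ t • v) h1 h2
      (by simp)
    simpa [hf, Function.comp_def] using h3
  have htend : Tendsto f (𝓝[>] 0) (𝓝 (Φ dstar)) := by
    rw [← hf0]; exact tendsto_nhdsWithin_of_tendsto_nhds hfat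
  have hpre : IsPreconnected (f '' Set.Ioo 0 ρ) := isPreconnected_Ioo.image f hfcont
  have hconst : ∀ t₀ ∈ Set.Ioo (0 : ℝ) ρ, f t₀ = Φ dstar := by
    intro t₀ ht₀
    rcases lt_trichotomy (f t₀) (Φ dstar) with hlt | heq | hgt
    · obtain ⟨k₁, hk₁K, hk₁⟩ := (hacc (Φ dstar - f t₀) (by linarith)).1
      have hk₁lo : f t₀ < k₁ := by have := hk₁.1; linarith
      have hk₁hi : k₁ < Φ dstar := hk₁.2
      have hev : ∀ᶠ t in 𝓝[>] (0 : ℝ), k₁ < f t ∧ t ∈ Set.Ioo 0 ρ :=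
        ((tendsto_order.1 htend).1 k₁ hk₁hi).and (Ioo_mem_nhdsGT hρpos)
      obtain ⟨t, hkt, ht⟩ := hev.exists
      have hsub : Set.Icc (f t₀) (f t) ⊆ f '' Set.Ioo 0 ρ :=
        hpre.Icc_subset (Set.mem_image_of_mem f ht₀) (Set.mem_image_of_mem f ht)
      obtain ⟨t₁, ht₁, hft₁⟩ := hsub ⟨hk₁lo.le, hkt.le⟩
      exact absurd (hft₁ ▸ hk₁K) (hnotK t₁ ht₁)
    · exact heq
    · obtain ⟨k₁, hk₁K, hk₁⟩ := (hacc (f t₀ - Φ dstar) (by linarith)).2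
      have hk₁lo : Φ dstar < k₁ := hk₁.1
      have hk₁hi : k₁ < f t₀ := by have := hk₁.2; linarith
      have hev : ∀ᶠ t in 𝓝[>] (0 : ℝ), f t < k₁ ∧ t ∈ Set.Ioo 0 ρ :=
        ((tendsto_order.1 htend).2 k₁ hk₁lo).and (Ioo_mem_nhdsGT hρpos)
      obtain ⟨t, hkt, ht⟩ := hev.exists
      have hsub : Set.Icc (f t) (f t₀) ⊆ f '' Set.Ioo 0 ρ :=
        hpre.Icc_subset (Set.mem_image_of_mem f ht) (Set.mem_image_of_mem f ht₀)
      obtain ⟨t₁, ht₁, hft₁⟩ := hsub ⟨hkt.le, hk₁hi.le⟩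
      exact absurd (hft₁ ▸ hk₁K) (hnotK t₁ ht₁)
  have hmid : ρ / 2 ∈ Set.Ioo (0 : ℝ) ρ := ⟨by positivity, by linarith⟩
  exact hnotK (ρ / 2) hmid ((hconst (ρ / 2) hmid).symm ▸ hk)

end Summit.FinalStateConjecture.FinalStateConjecture.Cruxes.TameExitsLocalise.Strategist.Repair

end
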